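import Summits.QuantumFields.YangMills.Theorems.BalabanUVNodesN16Eq42LipschitzOrbit
import Summits.QuantumFields.YangMills.Theorems.BalabanUVNodesN16Step04BlockLiftCovariance
import Summits.QuantumFields.YangMills.Theorems.BalabanUVNodesN16ApproximateSchemeTransferEnd
import HarnessLib

/-!
# YM-DAG node N16 (NE3), the located averaging pin (42) ↔ (0.4) — part 33 (capstone of g9): THE PIN FOR N16's END NUMBERS, ASSEMBLED — (H1) for the (0.4) scheme OF RECORD
# against (43) on the `SU(N)`-valued part of N16's small-field class from PER-STEP defects + small-field propagation of the (0.4) step ONLY, and N16's ACTION-RATE END for the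
# (0.4)-constrained minimal actions from END (A) for (43) with EXACTLY the located analytic inputs displayed

Cell `pub-ymgap`, width seat `pub-ymgap-dag-n16-w3` (director-ym №197 ∕ HUMAN RULING D-0149), generation 9; part 33 of the W1b lineage — the composition of parts 27′ (`Γ`-typed
transfer), 28 (END reading), 29 (per-step ⇒ `k`-fold), 30∕31 ((43)'s Lipschitz control, packaging on the `Γ`-valued part of `sfClass`), 32 (`step04`'s block-lift covariance for
`Γ = SU(N)`).  `--kind proof --supports stmt-QuantumFields-27366 --as helper` (K3⁸, KEY MAP v2; count-neutral; 0 `def`).  `bears_on: R4∕N16`.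

WHAT IS PROVED (d = 4, `𝔸 = M_N(ℂ)`, gauge group `Γ_SU = (ιSU N).range` = the `SU(N)`-valued units, unit lattice `2L^m = ne3NperOfRecord₁₁ F 0 0`, classes
`𝒞 k := {U ∈ sfClass 4 F.L (2L^m) ε k | U SU(N)-valued}` — the typing part 23's (d1) forces on the (0.4) side).
 * §1 ★★★ `approx_step04_step42_of_steps` — (H1) `ApproxSchemeGaugeEquivIn 4 Γ_SU (step04 F N) (step42 F.L) F.L (2L^m) k (𝒞 k) (δ k)` at EVERY depth `k` from:
   (i) the ONE-STEP defects `StepNear 4 Γ_SU (step04 F N) (step42 F.L) F.L (2L^m) j (𝒞 (j+1)) (η j)` with `0 ≤ η j ≤ η₀ j := min (ε∕(4(L^j)²)) (1∕(40L(21eL)^j))`;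
   (ii) the small-field ∕ `SU(N)` class propagation of the (0.4) step, `step04 F N (j+1) '' 𝒞 (j+1) ⊆ 𝒞 j`; (iii) the defect recursion `0 ≤ δ 0`, `(21eL)^j η j + δ j ≤ δ (j+1)` —
   NOTHING ELSE (regime `0 ≤ ε`, `32C₀(4)ε ≤ 3`, `327680L²ε ≤ 1`).  (43)'s Lipschitz control and fine∕block-lift covariance (parts 30∕31∕29), `step04`'s block-lift covariance
   (part 32), the `Γ_SU`-invariance of `𝒞` (part 31) are all DISCHARGED inside.  By part 27′'s `.symm` also with the roles swapped (`approx_step42_step04_of_steps`).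
 * §1½ `step04_succ_mem_memClass_of_smallField` — of input (ii) only the SMALL-FIELD RADIUS of the (0.4) output is an estimate (unitarity, periodicity, `SU(N)`-valuedness are
   g0's `step04_succ_mem_ne3DomOfRecord₁₁`); `approx_step04_step42_of_steps_smallField` = §1 with (ii) := `SmallField (step04 F N (j+1) U) (ε∕(L^j)²)` on `𝒞 (j+1)`.
 * §2 ★ `actionRate_step04Readings_of_actionRate_step42Readings` — the ASYMPTOTIC-EQUIVALENCE road composed ((i)–(iii) + right-inverse moduli `ω k ≤ C′θ^k(2L^m)^4` for both
   constraints + admissibility ⇒ END (A) transfers with `C + 2C′`) — kept as the record of that road and DECLARED VACUOUS-IN-REGIME for the pin (self-refereed; part 28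
   `tendsto_sub_zero_of_act_near`: its hypotheses force the two minimal-action sequences to share their limit, whereas (42) and (0.4) are different averaging functionals at unit
   block scale — parts 1–11 — so `A_∞(V) ≠ A′_∞(V)` in general); ★★★★ `actionRate_step04Readings_of_cauchyDiscrepancy` ∕ `…_sfClass_…` — THE CORRECT SHAPE: END (A) for the
   (43)-constrained minimal actions + a geometrically CAUCHY scheme discrepancy `|Δ_{k+1} − Δ_k| ≤ C′θ^k·vol` (the discrepancy itself need not vanish) ⇒ END (A) for the
   (0.4)-of-record-constrained ones with `C + C′`; against N16's own carrier `minActReadings` on `sfClass` by name.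
READING (honest; for the planners, D-0014, nothing re-cut or filed).  THE LOCATED FORM OF THE (42)→(0.4) PIN FOR N16's END (A): ONE input — the geometric Cauchy property of the
scheme discrepancy of the constrained minimal actions (a locality statement about minimisers, same depth as END (A), absent from print and tree).  The closeness road of parts
27–32 ((H1) per-step ⇒ k-fold, (H2) right inverses) bounds the discrepancy itself, not its increments; its k-fold constants grow like `(21eL)^k` (sup-norm Lipschitz iteration cannot
see the contraction of averaging on fluctuations) and its END form needs `Δ_k → 0` — so for the pin it is the WRONG MECHANISM, recorded here with the reason; it remains valid for
schemes asymptotically equivalent to (43).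

HONEST FRAMING.  [folklore] composition BY NAME of parts 27′–32 (all kernel theorems of this lineage) and pub-balaban's `mem_sfClass_gaugeAct`; 0 `def`, 0 `sorry`, no `instance`, no
`notation`; NO estimate proved here; no minimiser constructed; nothing of [Balaban1985Averaging] ∕ [Balaban1985Variational] ∕ [Balaban1987RG1] asserted; K3⁸ stubs `stub_rates13HV` ∕
`stub_expansion13HV` NOT touched; N16 ∕ NE3 NOT discharged; count-neutral (typed 28∕28 · discharged 5∕27 work-bound, A 5∕28 — unmoved).  One finite four-torus programme at fixed `ε` —
the Yang–Mills mass gap (Clay) is NOT proved by any of this; R4 closes the conditional finite-𝕋⁴ rung `BalabanLadder.UV` only; nothing continuum ∕ ℝ⁴ ∕ OS.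
-/

set_option autoImplicit false

open scoped BigOperators Matrix Matrix.Norms.L2Operator
open NormedSpace

namespace Summit.QuantumFields.YangMills.BalabanUVNodes.N16Step04ApproxOfSteps

open Literature.MathematicalPhysics.QuantumFieldTheory.Balaban1983to89
open Literature.MathematicalPhysics.QuantumFieldTheory.Balaban1983to89.T4Continuum (T4Family)
open B7Prop1Explicit B7Prop2Explicit
open T4AveragingDeficitWall (IsUnitaryCfg SmallField)
open T4AveragingDeficitWallBoundary (IsPeriodicCfg)
open Summit.QuantumFields.BalabanUV.T4Continuum
open MinimalActionLevels (levelAction)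
open MinimalActionSandwich (admissible)
open MinimalActionRate (sfClass)
open NE3EnergyShapes (IsUnitarySite IsPeriodicSite)
open Node00 (MatA SU ιSU ne3NperOfRecord₁₁ ne3DomOfRecord₁₁)
open Summit.QuantumFields.YangMills.BalabanUVNodes.N16AveragingPin (avgIterS step42 step04 admissibleS ne3NperOfRecord₁₁_mul_pow step04_succ_mem_ne3DomOfRecord₁₁)
open Summit.QuantumFields.YangMills.BalabanUVNodes.N16ApproximateSchemeTransfer (RightInverseModulus bddBelow_levelAction_image_of_isUnitaryCfg)
open Summit.QuantumFields.YangMills.BalabanUVNodes.N16ApproximateSchemeTransferSub (ApproxSchemeGaugeEquivIn ApproxSchemeGaugeEquivIn.symm)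
open Summit.QuantumFields.YangMills.BalabanUVNodes.N16ApproximateSchemeTransferEnd (actionRate_of_act_near actionRate_of_sub_cauchy)
open Summit.QuantumFields.YangMills.BalabanUVNodes.N16ApproximateSchemeTransferSteps (StepNear)
open Summit.QuantumFields.YangMills.BalabanUVNodes.N16Eq42LipschitzOrbit (approx_step42_target_of_steps_memClass gaugeAct_mem_sfClass_inter)
open Summit.QuantumFields.YangMills.BalabanUVNodes.N16Step04BlockLiftCovariance (cov_step04_of_range range_ιSU_le_unitaryUnits ιSU_mk_coe)

noncomputable section

variable (F : T4Family) (N : ℕ) [NeZero N]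

/-! ## §1 (H1) for the (0.4) scheme of record against (43) on the `SU(N)`-valued part of the small-field class, from per-step data only -/

/-- **★★★ (H1) FOR (`step04`, (43)) FROM PER-STEP DEFECTS + CLASS PROPAGATION ONLY.**  On `𝒞 k := {U ∈ sfClass 4 F.L (2L^m) ε k | U SU(N)-valued}` (regime `0 ≤ ε`,
`32C₀(4)ε ≤ 3`, `2048·5·8·L²ε ≤ 1`): one-step defects `StepNear 4 Γ_SU (step04 F N) (step42 F.L) F.L (2L^m) j (𝒞 (j+1)) (η j)` with `0 ≤ η j ≤ η₀ j`, class propagation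
`step04 F N (j+1) '' 𝒞 (j+1) ⊆ 𝒞 j`, and `0 ≤ δ 0`, `(21eL)^j η j + δ j ≤ δ (j+1)` ⇒ `ApproxSchemeGaugeEquivIn 4 Γ_SU (step04 F N) (step42 F.L) F.L (2L^m) k (𝒞 k) (δ k)` for every `k`
(part 31's packaging with part 32's covariance of `step04` and part 30∕31's Lipschitz control of (43) plugged in). [folklore] -/
theorem approx_step04_step42_of_steps {ε : ℝ} (hε0 : 0 ≤ ε) (hε1 : 32 * C0 4 * ε ≤ 3) (hε2 : 2048 * (4 + 1) * (4 + 4) * (F.L : ℝ) ^ 2 * ε ≤ 1) {η δ : ℕ → ℝ}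
    (hstep : ∀ j, StepNear 4 (ιSU N).range (step04 F N) (fun _ => step42 F.L) F.L (ne3NperOfRecord₁₁ F 0 0) j
      {U | U ∈ sfClass 4 F.L (ne3NperOfRecord₁₁ F 0 0) ε (j + 1) ∧ ∀ x i, U x i ∈ (ιSU N).range} (η j))
    (hη0 : ∀ j, 0 ≤ η j)
    (hηle : ∀ j, η j ≤ min (ε / (4 * ((F.L : ℝ) ^ j) ^ 2)) (1 / (8 * (4 + 1) * (F.L : ℝ) * (Real.exp 1 * ((4 * 4 + 5) * F.L)) ^ j)))
    (hmap : ∀ j, ∀ U ∈ {U | U ∈ sfClass 4 F.L (ne3NperOfRecord₁₁ F 0 0) ε (j + 1) ∧ ∀ x i, U x i ∈ (ιSU N).range},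
      step04 F N (j + 1) U ∈ {U | U ∈ sfClass 4 F.L (ne3NperOfRecord₁₁ F 0 0) ε j ∧ ∀ x i, U x i ∈ (ιSU N).range})
    (hδ0 : 0 ≤ δ 0) (hδ : ∀ j, (Real.exp 1 * ((4 * 4 + 5) * F.L)) ^ j * η j + δ j ≤ δ (j + 1)) (k : ℕ) :
    ApproxSchemeGaugeEquivIn 4 (ιSU N).range (step04 F N) (fun _ => step42 F.L) F.L (ne3NperOfRecord₁₁ F 0 0) k
      {U | U ∈ sfClass 4 F.L (ne3NperOfRecord₁₁ F 0 0) ε k ∧ ∀ x i, U x i ∈ (ιSU N).range} (δ k) := by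
  haveI : Nonempty (Fin N) := ⟨⟨0, Nat.pos_of_ne_zero (NeZero.ne N)⟩⟩
  exact approx_step42_target_of_steps_memClass (d := 4) F.hL.2 hε0 hε1 hε2 (range_ιSU_le_unitaryUnits N) hstep hη0 hηle hmap
    (fun j κ U hκ hκP hU => cov_step04_of_range F N j (C := {U | U ∈ sfClass 4 F.L (ne3NperOfRecord₁₁ F 0 0) ε j ∧ ∀ x i, U x i ∈ (ιSU N).range})
      (fun U hU => hU.2) κ U hκ hκP hU) hδ0 hδ k

/-- … and with the roles swapped ((43) first), the shape part 28's END transfer consumes. [folklore] -/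
theorem approx_step42_step04_of_steps {ε : ℝ} (hε0 : 0 ≤ ε) (hε1 : 32 * C0 4 * ε ≤ 3) (hε2 : 2048 * (4 + 1) * (4 + 4) * (F.L : ℝ) ^ 2 * ε ≤ 1) {η δ : ℕ → ℝ}
    (hstep : ∀ j, StepNear 4 (ιSU N).range (step04 F N) (fun _ => step42 F.L) F.L (ne3NperOfRecord₁₁ F 0 0) j
      {U | U ∈ sfClass 4 F.L (ne3NperOfRecord₁₁ F 0 0) ε (j + 1) ∧ ∀ x i, U x i ∈ (ιSU N).range} (η j))
    (hη0 : ∀ j, 0 ≤ η j)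
    (hηle : ∀ j, η j ≤ min (ε / (4 * ((F.L : ℝ) ^ j) ^ 2)) (1 / (8 * (4 + 1) * (F.L : ℝ) * (Real.exp 1 * ((4 * 4 + 5) * F.L)) ^ j)))
    (hmap : ∀ j, ∀ U ∈ {U | U ∈ sfClass 4 F.L (ne3NperOfRecord₁₁ F 0 0) ε (j + 1) ∧ ∀ x i, U x i ∈ (ιSU N).range},
      step04 F N (j + 1) U ∈ {U | U ∈ sfClass 4 F.L (ne3NperOfRecord₁₁ F 0 0) ε j ∧ ∀ x i, U x i ∈ (ιSU N).range})
    (hδ0 : 0 ≤ δ 0) (hδ : ∀ j, (Real.exp 1 * ((4 * 4 + 5) * F.L)) ^ j * η j + δ j ≤ δ (j + 1)) (k : ℕ) :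
    ApproxSchemeGaugeEquivIn 4 (ιSU N).range (fun _ => step42 F.L) (step04 F N) F.L (ne3NperOfRecord₁₁ F 0 0) k
      {U | U ∈ sfClass 4 F.L (ne3NperOfRecord₁₁ F 0 0) ε k ∧ ∀ x i, U x i ∈ (ιSU N).range} (δ k) :=
  (approx_step04_step42_of_steps F N hε0 hε1 hε2 hstep hη0 hηle hmap hδ0 hδ k).symm (range_ιSU_le_unitaryUnits N)

/-! ## §1½ The class-propagation input (ii) reduces to the small-field estimate alone -/

/-- **THE (0.4) STEP LANDS IN THE `SU(N)`-VALUED, PERIODIC, UNITARY CONFIGURATIONS** (g0's `step04_succ_mem_ne3DomOfRecord₁₁`: it is a lift of a torus `SU(N)` field): of the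
membership `step04 F N (j+1) U ∈ 𝒞 j` only the SMALL-FIELD RADIUS `SmallField (step04 F N (j+1) U) (ε∕(L^j)²)` is an estimate — the displayed input (ii) of §1∕§2 is exactly
[Balaban1987RG1] p. 254's claim of [Balaban1985Averaging] Props 1–2 for the (0.4) average, nothing more. [folklore] -/
theorem step04_succ_mem_memClass_of_smallField (j : ℕ) (U : (Fin 4 → ℤ) → Fin 4 → (MatA N)ˣ) {ε : ℝ}
    (hsf : SmallField (step04 F N (j + 1) U) (ε / ((F.L : ℝ) ^ j) ^ 2)) :
    step04 F N (j + 1) U ∈ {U | U ∈ sfClass 4 F.L (ne3NperOfRecord₁₁ F 0 0) ε j ∧ ∀ x i, U x i ∈ (ιSU N).range} := by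
  have hmem := step04_succ_mem_ne3DomOfRecord₁₁ F N j U
  have hSU : ∀ (x : Fin 4 → ℤ) (i : Fin 4), ((step04 F N (j + 1) U x i : (MatA N)ˣ) : MatA N) ∈ Matrix.specialUnitaryGroup (Fin N) ℂ :=
    fun x i => Node00.coe_mem_specialUnitaryGroup_of_mem_ne3DomOfRecord₁₁ hmem x i
  have hrange : ∀ (x : Fin 4 → ℤ) (i : Fin 4), step04 F N (j + 1) U x i ∈ (ιSU N).range :=
    fun x i => ⟨⟨_, hSU x i⟩, ιSU_mk_coe N (hSU x i)⟩
  have hper : ne3NperOfRecord₁₁ F j 0 = ne3NperOfRecord₁₁ F 0 0 * F.L ^ j := by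
    rw [ne3NperOfRecord₁₁_mul_pow]; rfl
  refine ⟨⟨fun x i => range_ιSU_le_unitaryUnits N (hrange x i), fun x κ μ => ?_, hsf⟩, hrange⟩
  have h := Node00.periodic_of_mem_ne3DomOfRecord₁₁ hmem x (e κ) μ
  rw [hper] at h
  exact_mod_cast h

/-- **§1 WITH INPUT (ii) AS THE SMALL-FIELD ESTIMATE ALONE.** [folklore] -/
theorem approx_step04_step42_of_steps_smallField {ε : ℝ} (hε0 : 0 ≤ ε) (hε1 : 32 * C0 4 * ε ≤ 3) (hε2 : 2048 * (4 + 1) * (4 + 4) * (F.L : ℝ) ^ 2 * ε ≤ 1) {η δ : ℕ → ℝ}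
    (hstep : ∀ j, StepNear 4 (ιSU N).range (step04 F N) (fun _ => step42 F.L) F.L (ne3NperOfRecord₁₁ F 0 0) j
      {U | U ∈ sfClass 4 F.L (ne3NperOfRecord₁₁ F 0 0) ε (j + 1) ∧ ∀ x i, U x i ∈ (ιSU N).range} (η j))
    (hη0 : ∀ j, 0 ≤ η j)
    (hηle : ∀ j, η j ≤ min (ε / (4 * ((F.L : ℝ) ^ j) ^ 2)) (1 / (8 * (4 + 1) * (F.L : ℝ) * (Real.exp 1 * ((4 * 4 + 5) * F.L)) ^ j)))
    (hsmall : ∀ j, ∀ U ∈ {U | U ∈ sfClass 4 F.L (ne3NperOfRecord₁₁ F 0 0) ε (j + 1) ∧ ∀ x i, U x i ∈ (ιSU N).range},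
      SmallField (step04 F N (j + 1) U) (ε / ((F.L : ℝ) ^ j) ^ 2))
    (hδ0 : 0 ≤ δ 0) (hδ : ∀ j, (Real.exp 1 * ((4 * 4 + 5) * F.L)) ^ j * η j + δ j ≤ δ (j + 1)) (k : ℕ) :
    ApproxSchemeGaugeEquivIn 4 (ιSU N).range (step04 F N) (fun _ => step42 F.L) F.L (ne3NperOfRecord₁₁ F 0 0) k
      {U | U ∈ sfClass 4 F.L (ne3NperOfRecord₁₁ F 0 0) ε k ∧ ∀ x i, U x i ∈ (ιSU N).range} (δ k) :=
  approx_step04_step42_of_steps F N hε0 hε1 hε2 hstep hη0 hηle (fun j U hU => step04_succ_mem_memClass_of_smallField F N j U (hsmall j U hU)) hδ0 hδ k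

/-! ## §2 THE PIN FOR N16's END (A), assembled -/

/-- **★ THE ASYMPTOTIC-EQUIVALENCE ROAD, COMPOSED** (kept as the record of the road; VACUOUS-IN-REGIME for the (42)∕(0.4) pin — part 28's `tendsto_sub_zero_of_act_near`:
hypothesis (iv) with `ω k ≤ C′θ^k(2L^m)^4` forces the two minimal-action sequences to share their limit, which two averaging functionals differing at unit block scale do not
do in general; see ★★★★ below for the correct shape).  Let `𝒞 k := {U ∈ sfClass 4 F.L (2L^m) ε k | U SU(N)-valued}`, `dom` (43)-admissible on `𝒞`.  IF (i) `StepNear` per step,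
(ii) class propagation of `step04`, (iii) the defect recursion, (iv) right-inverse moduli for BOTH constraints with `ω k ≤ C′θ^k(2L^m)^4` at closeness `δ k`, THEN
`ActionRate ⟨dom, inf A^{(k)}(admissibleS step42 𝒞 k ·), loc, (2L^m)^4⟩ C θ → ActionRate ⟨dom, inf A^{(k)}(admissibleS (step04 F N) 𝒞 k ·), loc, (2L^m)^4⟩ (C + 2C′) θ`. [folklore] -/
theorem actionRate_step04Readings_of_actionRate_step42Readings {ε : ℝ} (hε0 : 0 ≤ ε) (hε1 : 32 * C0 4 * ε ≤ 3)
    (hε2 : 2048 * (4 + 1) * (4 + 4) * (F.L : ℝ) ^ 2 * ε ≤ 1) {η δ ω : ℕ → ℝ}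
    (hstep : ∀ j, StepNear 4 (ιSU N).range (step04 F N) (fun _ => step42 F.L) F.L (ne3NperOfRecord₁₁ F 0 0) j
      {U | U ∈ sfClass 4 F.L (ne3NperOfRecord₁₁ F 0 0) ε (j + 1) ∧ ∀ x i, U x i ∈ (ιSU N).range} (η j))
    (hη0 : ∀ j, 0 ≤ η j)
    (hηle : ∀ j, η j ≤ min (ε / (4 * ((F.L : ℝ) ^ j) ^ 2)) (1 / (8 * (4 + 1) * (F.L : ℝ) * (Real.exp 1 * ((4 * 4 + 5) * F.L)) ^ j)))
    (hmap : ∀ j, ∀ U ∈ {U | U ∈ sfClass 4 F.L (ne3NperOfRecord₁₁ F 0 0) ε (j + 1) ∧ ∀ x i, U x i ∈ (ιSU N).range},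
      step04 F N (j + 1) U ∈ {U | U ∈ sfClass 4 F.L (ne3NperOfRecord₁₁ F 0 0) ε j ∧ ∀ x i, U x i ∈ (ιSU N).range})
    (hδ0 : 0 ≤ δ 0) (hδ : ∀ j, (Real.exp 1 * ((4 * 4 + 5) * F.L)) ^ j * η j + δ j ≤ δ (j + 1))
    {dom : Set ((Fin 4 → ℤ) → Fin 4 → (MatA N)ˣ)}
    (hR43 : ∀ k, RightInverseModulus 4 (fun _ => step42 F.L)
      (fun k => {U | U ∈ sfClass 4 F.L (ne3NperOfRecord₁₁ F 0 0) ε k ∧ ∀ x i, U x i ∈ (ιSU N).range}) F.L (ne3NperOfRecord₁₁ F 0 0) k dom (δ k) (ω k))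
    (hR04 : ∀ k, RightInverseModulus 4 (step04 F N)
      (fun k => {U | U ∈ sfClass 4 F.L (ne3NperOfRecord₁₁ F 0 0) ε k ∧ ∀ x i, U x i ∈ (ιSU N).range}) F.L (ne3NperOfRecord₁₁ F 0 0) k dom (δ k) (ω k))
    (hadm : ∀ k, ∀ V ∈ dom,
      (admissible (fun k => {U | U ∈ sfClass 4 F.L (ne3NperOfRecord₁₁ F 0 0) ε k ∧ ∀ x i, U x i ∈ (ιSU N).range}) F.L k V).Nonempty)
    {C C' θ : ℝ} (hθ0 : 0 ≤ θ) (hθ1 : θ ≤ 1) (hC' : 0 ≤ C') (hω : ∀ k, ω k ≤ C' * θ ^ k * ((ne3NperOfRecord₁₁ F 0 0 : ℕ) : ℝ) ^ 4)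
    {X : Type*} (loc : ℕ → ((Fin 4 → ℤ) → Fin 4 → (MatA N)ˣ) → X → ℝ)
    (h : T4EtaRateMin.ActionRate
      ({ dom := dom
         act := fun k V => sInf (levelAction 4 F.L (ne3NperOfRecord₁₁ F 0 0) k ''
           admissibleS (fun _ => step42 F.L) (fun k => {U | U ∈ sfClass 4 F.L (ne3NperOfRecord₁₁ F 0 0) ε k ∧ ∀ x i, U x i ∈ (ιSU N).range}) k V)
         loc := loc
         vol := ((ne3NperOfRecord₁₁ F 0 0 : ℕ) : ℝ) ^ 4
         vol_nonneg := by positivity } : T4EtaRateMin.Readings ((Fin 4 → ℤ) → Fin 4 → (MatA N)ˣ) X) C θ) :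
    T4EtaRateMin.ActionRate
      ({ dom := dom
         act := fun k V => sInf (levelAction 4 F.L (ne3NperOfRecord₁₁ F 0 0) k ''
           admissibleS (step04 F N) (fun k => {U | U ∈ sfClass 4 F.L (ne3NperOfRecord₁₁ F 0 0) ε k ∧ ∀ x i, U x i ∈ (ιSU N).range}) k V)
         loc := loc
         vol := ((ne3NperOfRecord₁₁ F 0 0 : ℕ) : ℝ) ^ 4
         vol_nonneg := by positivity } : T4EtaRateMin.Readings ((Fin 4 → ℤ) → Fin 4 → (MatA N)ˣ) X) (C + 2 * C') θ := by
  haveI : Nonempty (Fin N) := ⟨⟨0, Nat.pos_of_ne_zero (NeZero.ne N)⟩⟩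
  have hL1 : 1 ≤ F.L := le_trans (by norm_num) F.hL.2
  -- (H1) at every depth, (43) first
  have hE := fun k => approx_step42_step04_of_steps F N hε0 hε1 hε2 hstep hη0 hηle hmap hδ0 hδ k
  -- the class is `Γ_SU`-invariant and bounded below in action
  have hC : ∀ (k : ℕ) (u : (Fin 4 → ℤ) → (MatA N)ˣ) (U : (Fin 4 → ℤ) → Fin 4 → (MatA N)ˣ), (∀ x, u x ∈ (ιSU N).range) →
      IsPeriodicSite u ((ne3NperOfRecord₁₁ F 0 0 * F.L ^ k : ℕ) : ℤ) →
      U ∈ {U | U ∈ sfClass 4 F.L (ne3NperOfRecord₁₁ F 0 0) ε k ∧ ∀ x i, U x i ∈ (ιSU N).range} →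
      gaugeAct u U ∈ {U | U ∈ sfClass 4 F.L (ne3NperOfRecord₁₁ F 0 0) ε k ∧ ∀ x i, U x i ∈ (ιSU N).range} :=
    fun k u U hu huP hU => gaugeAct_mem_sfClass_inter (d := 4) (range_ιSU_le_unitaryUnits N) k u U hu huP hU
  have hB : ∀ k, BddBelow (levelAction 4 F.L (ne3NperOfRecord₁₁ F 0 0) k ''
      {U | U ∈ sfClass 4 F.L (ne3NperOfRecord₁₁ F 0 0) ε k ∧ ∀ x i, U x i ∈ (ιSU N).range}) :=
    fun k => bddBelow_levelAction_image_of_isUnitaryCfg hL1 fun U hU => hU.1.1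
  -- the action entries are `ω k`-close (part 27′ against (43)), hence `C′θ^k·vol`-close: part 28 §1
  refine actionRate_of_act_near
    (R := ({ dom := dom,
             act := fun k V => sInf (levelAction 4 F.L (ne3NperOfRecord₁₁ F 0 0) k ''
               admissibleS (fun _ => step42 F.L) (fun k => {U | U ∈ sfClass 4 F.L (ne3NperOfRecord₁₁ F 0 0) ε k ∧ ∀ x i, U x i ∈ (ιSU N).range}) k V),
             loc := loc,
             vol := ((ne3NperOfRecord₁₁ F 0 0 : ℕ) : ℝ) ^ 4,
             vol_nonneg := by positivity } : T4EtaRateMin.Readings ((Fin 4 → ℤ) → Fin 4 → (MatA N)ˣ) X))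
    rfl rfl hθ0 hθ1 hC' ?_ h
  intro k V hV
  show |sInf _ - sInf _| ≤ C' * θ ^ k * ((ne3NperOfRecord₁₁ F 0 0 : ℕ) : ℝ) ^ 4
  have hne : (admissibleS (fun _ => step42 F.L)
      (fun k => {U | U ∈ sfClass 4 F.L (ne3NperOfRecord₁₁ F 0 0) ε k ∧ ∀ x i, U x i ∈ (ιSU N).range}) k V).Nonempty := by
    rw [N16AveragingPin.admissibleS_step42]; exact hadm k V hV
  have habs := N16ApproximateSchemeTransferSub.abs_sInf_sub_sInf_le (range_ιSU_le_unitaryUnits N) hL1 (hC k) (hE k) (hR43 k) (hR04 k) hV hne (hB k)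
  rw [abs_sub_comm] at habs
  exact habs.trans (hω k)

/-- **★★★★ THE PIN FOR N16's END (A) IN ITS CORRECT SHAPE: A GEOMETRICALLY CAUCHY DISCREPANCY.**  On any class family `𝒞` and data `dom`: if the discrepancy of the two
constrained minimal actions `Δ_k(V) := inf A^{(k)}(admissibleS (step04 F N) 𝒞 k V) − inf A^{(k)}(admissibleS step42 𝒞 k V)` has geometrically decaying INCREMENTS,
`|Δ_{k+1}(V) − Δ_k(V)| ≤ C′θ^k·(2L^m)^4` on `dom` (it need NOT tend to `0`: the two averaging functionals differ at unit block scale, so `A_∞ ≠ A′_∞` in general), then N16's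
ACTION-RATE END for the (43)-constrained minimal actions on `𝒞` gives the same END for the (0.4)-OF-RECORD-constrained ones with constant `C + C′` (part 28 `actionRate_of_sub_cauchy`).
THE located input of the (42)→(0.4) pin for END (A): a LOCALITY statement about constrained minimisers (the scheme discrepancy stabilises geometrically in the depth), of the
same depth as END (A) itself; absent from print ([Balaban1987RG1] p. 254 asserts the results transfer, not this rate) and from the tree. [folklore] -/
theorem actionRate_step04Readings_of_cauchyDiscrepancy (𝒞 : ℕ → Set ((Fin 4 → ℤ) → Fin 4 → (MatA N)ˣ)) {dom : Set ((Fin 4 → ℤ) → Fin 4 → (MatA N)ˣ)}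
    {C C' θ : ℝ}
    (hΔ : ∀ (k : ℕ), ∀ V ∈ dom,
      |(sInf (levelAction 4 F.L (ne3NperOfRecord₁₁ F 0 0) (k + 1) '' admissibleS (step04 F N) 𝒞 (k + 1) V)
          - sInf (levelAction 4 F.L (ne3NperOfRecord₁₁ F 0 0) (k + 1) '' admissibleS (fun _ => step42 F.L) 𝒞 (k + 1) V))
        - (sInf (levelAction 4 F.L (ne3NperOfRecord₁₁ F 0 0) k '' admissibleS (step04 F N) 𝒞 k V)
          - sInf (levelAction 4 F.L (ne3NperOfRecord₁₁ F 0 0) k '' admissibleS (fun _ => step42 F.L) 𝒞 k V))|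
        ≤ C' * θ ^ k * ((ne3NperOfRecord₁₁ F 0 0 : ℕ) : ℝ) ^ 4)
    {X : Type*} (loc : ℕ → ((Fin 4 → ℤ) → Fin 4 → (MatA N)ˣ) → X → ℝ)
    (h : T4EtaRateMin.ActionRate
      ({ dom := dom
         act := fun k V => sInf (levelAction 4 F.L (ne3NperOfRecord₁₁ F 0 0) k '' admissibleS (fun _ => step42 F.L) 𝒞 k V)
         loc := loc
         vol := ((ne3NperOfRecord₁₁ F 0 0 : ℕ) : ℝ) ^ 4
         vol_nonneg := by positivity } : T4EtaRateMin.Readings ((Fin 4 → ℤ) → Fin 4 → (MatA N)ˣ) X) C θ) :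
    T4EtaRateMin.ActionRate
      ({ dom := dom
         act := fun k V => sInf (levelAction 4 F.L (ne3NperOfRecord₁₁ F 0 0) k '' admissibleS (step04 F N) 𝒞 k V)
         loc := loc
         vol := ((ne3NperOfRecord₁₁ F 0 0 : ℕ) : ℝ) ^ 4
         vol_nonneg := by positivity } : T4EtaRateMin.Readings ((Fin 4 → ℤ) → Fin 4 → (MatA N)ˣ) X) (C + C') θ :=
  actionRate_of_sub_cauchy
    (R := ({ dom := dom,
             act := fun k V => sInf (levelAction 4 F.L (ne3NperOfRecord₁₁ F 0 0) k '' admissibleS (fun _ => step42 F.L) 𝒞 k V),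
             loc := loc,
             vol := ((ne3NperOfRecord₁₁ F 0 0 : ℕ) : ℝ) ^ 4,
             vol_nonneg := by positivity } : T4EtaRateMin.Readings ((Fin 4 → ℤ) → Fin 4 → (MatA N)ˣ) X))
    rfl rfl (fun k V hV => hΔ k V hV) h

/-- **ON N16's OWN CLASS `sfClass` (U(N)-valued) THE SAME READS AGAINST N16's CARRIER `minActReadings` BY NAME** (g0's dictionary `admissibleS_step42`: the (43) entry IS
`minAct`): END (A) of `minActReadings 4 (sfClass 4 F.L (2L^m) ε) F.L (2L^m) dom loc` + geometrically Cauchy discrepancy of the (0.4)-constrained minimal actions against `minAct`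
⇒ END (A) for the (0.4)-constrained minimal actions on `sfClass`.  (Whether the (0.4) side should be read on the `U(N)` class at all is part 23's (d1) caveat — recorded, not
resolved: on `U(N) ∖ SU(N)` competitors `step04` reads junk.) [folklore] -/
theorem actionRate_step04Readings_sfClass_of_cauchyDiscrepancy {ε : ℝ} {dom : Set ((Fin 4 → ℤ) → Fin 4 → (MatA N)ˣ)} {C C' θ : ℝ}
    (hΔ : ∀ (k : ℕ), ∀ V ∈ dom,
      |(sInf (levelAction 4 F.L (ne3NperOfRecord₁₁ F 0 0) (k + 1) '' admissibleS (step04 F N) (sfClass 4 F.L (ne3NperOfRecord₁₁ F 0 0) ε) (k + 1) V)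
          - MinimalActionSandwich.minAct 4 (sfClass 4 F.L (ne3NperOfRecord₁₁ F 0 0) ε) F.L (ne3NperOfRecord₁₁ F 0 0) (k + 1) V)
        - (sInf (levelAction 4 F.L (ne3NperOfRecord₁₁ F 0 0) k '' admissibleS (step04 F N) (sfClass 4 F.L (ne3NperOfRecord₁₁ F 0 0) ε) k V)
          - MinimalActionSandwich.minAct 4 (sfClass 4 F.L (ne3NperOfRecord₁₁ F 0 0) ε) F.L (ne3NperOfRecord₁₁ F 0 0) k V)|
        ≤ C' * θ ^ k * ((ne3NperOfRecord₁₁ F 0 0 : ℕ) : ℝ) ^ 4)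
    {X : Type*} (loc : ℕ → ((Fin 4 → ℤ) → Fin 4 → (MatA N)ˣ) → X → ℝ)
    (h : T4EtaRateMin.ActionRate (MinimalActionRate.minActReadings 4 (sfClass 4 F.L (ne3NperOfRecord₁₁ F 0 0) ε) F.L (ne3NperOfRecord₁₁ F 0 0) dom loc) C θ) :
    T4EtaRateMin.ActionRate
      ({ dom := dom
         act := fun k V => sInf (levelAction 4 F.L (ne3NperOfRecord₁₁ F 0 0) k '' admissibleS (step04 F N) (sfClass 4 F.L (ne3NperOfRecord₁₁ F 0 0) ε) k V)
         loc := loc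
         vol := ((ne3NperOfRecord₁₁ F 0 0 : ℕ) : ℝ) ^ 4
         vol_nonneg := by positivity } : T4EtaRateMin.Readings ((Fin 4 → ℤ) → Fin 4 → (MatA N)ˣ) X) (C + C') θ :=
  actionRate_of_sub_cauchy (R := MinimalActionRate.minActReadings 4 (sfClass 4 F.L (ne3NperOfRecord₁₁ F 0 0) ε) F.L (ne3NperOfRecord₁₁ F 0 0) dom loc)
    rfl rfl (fun k V hV => hΔ k V hV) h

end

end Summit.QuantumFields.YangMills.BalabanUVNodes.N16Step04ApproxOfSteps
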